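import Summits.ResolutionOfSingularities.ResolutionOfSingularities.Theorems.FrobeniusLadderFInjectiveMacaulayficationGradedConeFiModelRel
import Summits.ResolutionOfSingularities.ResolutionOfSingularities.Theorems.FrobeniusLadderFInjectiveMacaulayficationE8WeightedData
import Summits.ResolutionOfSingularities.ResolutionOfSingularities.Theorems.FrobeniusLadderFInjectiveMacaulayficationE8Forms
import Summits.ResolutionOfSingularities.ResolutionOfSingularities.Theorems.FrobeniusLadderFInjectiveMacaulayficationE8OffCentreRegular
import Summits.ResolutionOfSingularities.ResolutionOfSingularities.Theorems.FrobeniusLadderFInjectiveMacaulayficationGradedEngineOfChartClause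
import Summits.ResolutionOfSingularities.ResolutionOfSingularities.Theorems.FrobeniusLadderFInjectiveMacaulayficationHypersurfaceRegular
import Summits.ResolutionOfSingularities.ResolutionOfSingularities.Theorems.FrobeniusLadderFInjectiveMacaulayficationThreefoldNotDvd
import Mathlib.RingTheory.Polynomial.Quotient
import HarnessLib

/-!
# G6-rel: `E₈⁰ × 𝔸¹` — THE FIRST GRADED CALIBRATION WITH A NON-ISOLATED BAD LOCUS, at EVERY prime `p`
# (crux `FrobeniusLadder.FInjectiveMacaulayfication` stmt-ResolutionOfSingularities-15315, chain w45a; calibration of the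
# relative graded engine (H3-gd-rel) `GradedConeFiModelRel.gradedConeFiModelRel` p499962; lead seat res-L1-w45a-lead-1 gen 3)

[OURS · L1 W4.5a] AI-written; AI review is weaker than expert review. NOT a statement of any manuscript; no named fact.

`f = X₃² + X₁³ + X₂⁵ ∈ k[X₀, X₁, X₂, X₃]` (the `E₈⁰` cone in the variables `X₁, X₂, X₃`, times the affine line with coordinate
`X₀`). Its singular locus — and at `p = 2, 3, 5` its non-F-injective locus — is the LINE `V(X₁, X₂, X₃)`, a non-isolated bad
locus (idea-2's hand specimen `E₈⁰ × 𝔸¹`, for which the blow-up of the REDUCED ideal of the line was shown to leave a bad `E₇⁰`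
curve at `p = 3`). THEOREM: for EVERY prime `p` and every field of characteristic `p`, the weighted blow-up of
`Spec k[X]/(f)` along that line with weights `(0, 10, 6, 15)` (centre `I₃₀`, charts `X₁³, X₂⁵, X₃²`) is a proper birational
model with domain stalks satisfying the crux clause at every point — ONE application of `gradedConeFiModelRel` with
`J = {1,2,3}`. Inputs: Veronese saturation for `(0,10,6,15)` (from `E8WeightedData.coord_split`), primality of `(f)` (from
`E8Forms` along `k[X₀,…,X₃] ≃ k[X₁,X₂,X₃][X₀]`), `x̄_v ≠ 0`, and the clause off the line: there `k[X]/(f)` is REGULAR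
(uniformly in `p`: a prime missing one of `x̄₁, x̄₂, x̄₃` misses two of them, and of the partials `3X₁², 5X₂⁴, 2X₃` at most one
coefficient vanishes in `k`). No definitions, no named facts. [folklore]
-/

set_option linter.dupNamespace false

noncomputable section

open Literature.AlgebraicGeometry.Resolution AlgebraicGeometry MvPolynomial

namespace Summit.ResolutionOfSingularities.ResolutionOfSingularities.Theorems.FInjectiveMacaulayfication.E8LineGradedFiModel

open Summit.ResolutionOfSingularities.ResolutionOfSingularities.Theorems.FInjectiveMacaulayfication

/-! ## Weights `(0,10,6,15)`: weighted degree, homogeneity of `f`, Veronese saturation -/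

/-- The `(0,10,6,15)`-weighted degree in coordinates. [folklore] -/
theorem weight_eq (a : Fin 4 →₀ ℕ) :
    Finsupp.weight (![0, 10, 6, 15] : Fin 4 → ℕ) a = 10 * a 1 + 6 * a 2 + 15 * a 3 := by
  rw [Finsupp.weight_apply,
    Finsupp.sum_fintype a (fun i c => c • (![0, 10, 6, 15] : Fin 4 → ℕ) i) (fun _ => zero_smul ℕ _),
    Fin.sum_univ_four]
  simp only [smul_eq_mul, Matrix.cons_val_zero, Matrix.cons_val_one, Matrix.cons_val]
  ring

/-- `f = X₃² + X₁³ + X₂⁵` is `(0,10,6,15)`-weighted homogeneous of weight `30`. [folklore] -/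
theorem f_isWeightedHomogeneous (k : Type) [Field k] :
    MvPolynomial.IsWeightedHomogeneous (![0, 10, 6, 15] : Fin 4 → ℕ)
      (X 3 ^ 2 + X 1 ^ 3 + X 2 ^ 5 : MvPolynomial (Fin 4) k) 30 := by
  refine ((?_ : IsWeightedHomogeneous _ _ 30).add ?_).add ?_
  · simpa using (isWeightedHomogeneous_X k (![0, 10, 6, 15] : Fin 4 → ℕ) 3).pow 2
  · simpa using (isWeightedHomogeneous_X k (![0, 10, 6, 15] : Fin 4 → ℕ) 1).pow 3
  · simpa using (isWeightedHomogeneous_X k (![0, 10, 6, 15] : Fin 4 → ℕ) 2).pow 5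

/-- Exponent-vector splitting for `(0,10,6,15)`, `N = 30` (the `X₀`-exponent rides along in the second factor).
[folklore] -/
theorem finsupp_split (K : ℕ) (a : Fin 4 →₀ ℕ)
    (ha : (K + 1) * 30 ≤ Finsupp.weight (![0, 10, 6, 15] : Fin 4 → ℕ) a) :
    ∃ b c : Fin 4 →₀ ℕ, a = b + c ∧ 30 ≤ Finsupp.weight (![0, 10, 6, 15] : Fin 4 → ℕ) b ∧
      K * 30 ≤ Finsupp.weight (![0, 10, 6, 15] : Fin 4 → ℕ) c := by
  rw [weight_eq] at ha
  obtain ⟨b₀, b₁, b₂, c₀, c₁, c₂, e₀, e₁, e₂, hb, hc⟩ := E8WeightedData.coord_split K (a 1) (a 2) (a 3) ha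
  refine ⟨Finsupp.equivFunOnFinite.symm ![0, b₀, b₁, b₂], Finsupp.equivFunOnFinite.symm ![a 0, c₀, c₁, c₂], ?_, ?_, ?_⟩
  · ext i
    fin_cases i <;> simp [e₀, e₁, e₂]
  · rw [weight_eq]
    simpa using hb
  · rw [weight_eq]
    simpa using hc

/-- **VERONESE SATURATION for `(0,10,6,15)`, `N = 30`**: every monomial of weighted degree `≥ 30K` lies in `I₃₀^K`.
[folklore] -/
theorem veroneseSplitting (k : Type) [Field k] : ∀ (K : ℕ) (a : Fin 4 →₀ ℕ),
    K * 30 ≤ Finsupp.weight (![0, 10, 6, 15] : Fin 4 → ℕ) a →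
    (MvPolynomial.monomial a (1 : k) : MvPolynomial (Fin 4) k) ∈
      (Ideal.span {m : MvPolynomial (Fin 4) k | ∃ b : Fin 4 →₀ ℕ,
        30 ≤ Finsupp.weight (![0, 10, 6, 15] : Fin 4 → ℕ) b ∧ m = MvPolynomial.monomial b 1}) ^ K := by
  intro K
  induction K with
  | zero =>
    intro a _
    rw [pow_zero, Ideal.one_eq_top]
    exact Submodule.mem_top
  | succ K ih =>
    intro a ha
    obtain ⟨b, c, rfl, hb, hc⟩ := finsupp_split K a ha
    have hmul : (MvPolynomial.monomial (b + c) (1 : k) : MvPolynomial (Fin 4) k) =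
        MvPolynomial.monomial b 1 * MvPolynomial.monomial c 1 := by
      rw [MvPolynomial.monomial_mul, one_mul]
    rw [pow_succ', hmul]
    exact Ideal.mul_mem_mul (Ideal.subset_span ⟨b, hb, rfl⟩) (ih c hc)

/-! ## Primality of `(f)` in four variables and `x̄_v ≠ 0` -/

/-- `(X₃² + X₁³ + X₂⁵)` is prime in `k[X₀,…,X₃]`: along `k[X₀,…,X₃] ≃ k[X₁,X₂,X₃][X₀]` (`finSuccEquiv`) it is the extension
of the prime `(E₈⁰)` of `k[X₁,X₂,X₃]` (`E8Forms`) to the polynomial ring. [folklore] -/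
theorem isPrime_span_f (k : Type) [Field k] (f : MvPolynomial (Fin 4) k) (hf : f = X 3 ^ 2 + X 1 ^ 3 + X 2 ^ 5) :
    (Ideal.span {f}).IsPrime := by
  obtain ⟨⟨hp3, -, -⟩, -, -⟩ := E8Forms.stub_e8Forms k (X 2 ^ 2 + X 0 ^ 3 + X 1 ^ 5) _ _ rfl rfl rfl
  have hX1 : MvPolynomial.finSuccEquiv k 3 (X 1 : MvPolynomial (Fin 4) k) = Polynomial.C (X 0) :=
    MvPolynomial.finSuccEquiv_X_succ (j := 0)
  have hX2 : MvPolynomial.finSuccEquiv k 3 (X 2 : MvPolynomial (Fin 4) k) = Polynomial.C (X 1) :=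
    MvPolynomial.finSuccEquiv_X_succ (j := 1)
  have hX3 : MvPolynomial.finSuccEquiv k 3 (X 3 : MvPolynomial (Fin 4) k) = Polynomial.C (X 2) :=
    MvPolynomial.finSuccEquiv_X_succ (j := 2)
  have hef : MvPolynomial.finSuccEquiv k 3 f = Polynomial.C (X 2 ^ 2 + X 0 ^ 3 + X 1 ^ 5 : MvPolynomial (Fin 3) k) := by
    subst hf
    simp only [map_add, map_pow, hX1, hX2, hX3]
  haveI hC : (Ideal.span {Polynomial.C (X 2 ^ 2 + X 0 ^ 3 + X 1 ^ 5 : MvPolynomial (Fin 3) k)}).IsPrime := by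
    rw [← Set.image_singleton, ← Ideal.map_span]
    haveI := hp3
    exact Ideal.isPrime_map_C_of_isPrime
  have hspan : Ideal.span {f} =
      (Ideal.span {Polynomial.C (X 2 ^ 2 + X 0 ^ 3 + X 1 ^ 5 : MvPolynomial (Fin 3) k)}).map
        ((MvPolynomial.finSuccEquiv k 3).symm : Polynomial (MvPolynomial (Fin 3) k) →+* MvPolynomial (Fin 4) k) := by
    rw [Ideal.map_span, Set.image_singleton, RingHom.coe_coe, ← hef, AlgEquiv.symm_apply_apply]
  rw [hspan]
  exact Ideal.map_isPrime_of_equiv _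

/-- No variable lies in `(f)`: evaluate at a point with `X_v = 0` and `f = 1`. [folklore] -/
theorem X_ne_zero (k : Type) [Field k] (f : MvPolynomial (Fin 4) k) (hf : f = X 3 ^ 2 + X 1 ^ 3 + X 2 ^ 5)
    (v : Fin 4) : Ideal.Quotient.mk (Ideal.span {f}) (MvPolynomial.X v) ≠ 0 := by
  intro h
  refine PrimeTransfer.X_not_mem_span_of_isPrime (isPrime_span_f k f hf) ?_ (Ideal.Quotient.eq_zero_iff_mem.mp h)
  fin_cases v
  · refine ThreefoldNotDvd.not_mem_span_X_of_eval_eq_one 0 ![0, 1, 0, 0] rfl ?_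
    subst hf; simp
  · refine ThreefoldNotDvd.not_mem_span_X_of_eval_eq_one 1 ![0, 0, 0, 1] rfl ?_
    subst hf; simp
  · refine ThreefoldNotDvd.not_mem_span_X_of_eval_eq_one 2 ![0, 0, 0, 1] rfl ?_
    subst hf; simp
  · refine ThreefoldNotDvd.not_mem_span_X_of_eval_eq_one 3 ![0, 1, 0, 0] rfl ?_
    subst hf; simp

/-! ## Regularity off the line `V(X₁,X₂,X₃)`, uniformly in the characteristic -/

/-- `∂f/∂X₁ = 3X₁²`. [folklore] -/
theorem pderiv_one_f {A : Type*} [CommRing A] :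
    pderiv 1 (X 3 ^ 2 + X 1 ^ 3 + X 2 ^ 5 : MvPolynomial (Fin 4) A) = C 3 * X 1 ^ 2 := by
  simp only [map_add, pderiv_pow, pderiv_X_self, pderiv_X_of_ne (show (3 : Fin 4) ≠ 1 by decide),
    pderiv_X_of_ne (show (2 : Fin 4) ≠ 1 by decide), mul_zero, zero_add, add_zero, mul_one]
  rw [map_ofNat]
  norm_num

/-- `∂f/∂X₂ = 5X₂⁴`. [folklore] -/
theorem pderiv_two_f {A : Type*} [CommRing A] :
    pderiv 2 (X 3 ^ 2 + X 1 ^ 3 + X 2 ^ 5 : MvPolynomial (Fin 4) A) = C 5 * X 2 ^ 4 := by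
  simp only [map_add, pderiv_pow, pderiv_X_self, pderiv_X_of_ne (show (3 : Fin 4) ≠ 2 by decide),
    pderiv_X_of_ne (show (1 : Fin 4) ≠ 2 by decide), mul_zero, zero_add, add_zero, mul_one]
  rw [map_ofNat]
  norm_num

/-- `∂f/∂X₃ = 2X₃`. [folklore] -/
theorem pderiv_three_f {A : Type*} [CommRing A] :
    pderiv 3 (X 3 ^ 2 + X 1 ^ 3 + X 2 ^ 5 : MvPolynomial (Fin 4) A) = C 2 * X 3 := by
  simp only [map_add, pderiv_pow, pderiv_X_self, pderiv_X_of_ne (show (1 : Fin 4) ≠ 3 by decide),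
    pderiv_X_of_ne (show (2 : Fin 4) ≠ 3 by decide), mul_zero, add_zero, mul_one]
  rw [map_ofNat]
  norm_num

/-- **`E₈⁰ × 𝔸¹` is regular off the line**, in every characteristic: a prime `P` of `R = k[X]/(f)` missing one of
`x̄₁, x̄₂, x̄₃` has `R_P` regular. Two of the three variables must be missing (one alone in `P`'s complement contradicts
`f ∈ P`), and of the coefficients `3, 5, 2` of the partials `3X₁², 5X₂⁴, 2X₃` at most one vanishes in a field, so the
Jacobian criterion (`HypersurfaceRegular.stub_hypersurfaceRegularOfPderiv`) applies to one of them. [folklore] -/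
theorem regular_off_line (k : Type) [Field k] (f : MvPolynomial (Fin 4) k) (hf : f = X 3 ^ 2 + X 1 ^ 3 + X 2 ^ 5)
    (P : Ideal (MvPolynomial (Fin 4) k ⧸ Ideal.span {f})) [P.IsPrime]
    (hP : ¬ Ideal.span ((fun j : Fin 4 => Ideal.Quotient.mk (Ideal.span {f}) (MvPolynomial.X j)) ''
      ((({1, 2, 3} : Finset (Fin 4)) : Set (Fin 4)))) ≤ P) :
    IsRegularLocalRing (Localization.AtPrime P) := by
  haveI hprime : (P.comap (Ideal.Quotient.mk (Ideal.span {f}))).IsPrime := Ideal.comap_isPrime _ _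
  have hfP : f ∈ P.comap (Ideal.Quotient.mk (Ideal.span {f})) := by
    rw [Ideal.mem_comap, Ideal.Quotient.eq_zero_iff_mem.mpr (Ideal.mem_span_singleton_self f)]
    exact P.zero_mem
  -- at most one of `2, 3, 5` vanishes in the field `k`
  have h23 : (2 : k) = 0 → (3 : k) ≠ 0 := fun h2 h3 => one_ne_zero (by linear_combination h3 - h2 : (1 : k) = 0)
  have h25 : (2 : k) = 0 → (5 : k) ≠ 0 := fun h2 h5 => one_ne_zero (by linear_combination h5 - 2 * h2 : (1 : k) = 0)
  have h35 : (3 : k) = 0 → (5 : k) ≠ 0 := fun h3 h5 => one_ne_zero (by linear_combination 2 * h3 - h5 : (1 : k) = 0)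
  -- the three Jacobian exits
  by_cases hA : (X 1 : MvPolynomial (Fin 4) k) ∉ P.comap (Ideal.Quotient.mk (Ideal.span {f})) ∧ (3 : k) ≠ 0
  · refine HypersurfaceRegular.stub_hypersurfaceRegularOfPderiv k 4 f 1 P (fun hd => hA.1 ?_)
    have e : pderiv 1 f = C 3 * X 1 ^ 2 := by rw [hf]; exact pderiv_one_f
    rw [e] at hd
    exact hprime.mem_of_pow_mem 2 (E8OffCentreRegular.mem_of_C_mul_mem _ hA.2 hd)
  by_cases hB : (X 2 : MvPolynomial (Fin 4) k) ∉ P.comap (Ideal.Quotient.mk (Ideal.span {f})) ∧ (5 : k) ≠ 0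
  · refine HypersurfaceRegular.stub_hypersurfaceRegularOfPderiv k 4 f 2 P (fun hd => hB.1 ?_)
    have e : pderiv 2 f = C 5 * X 2 ^ 4 := by rw [hf]; exact pderiv_two_f
    rw [e] at hd
    exact hprime.mem_of_pow_mem 4 (E8OffCentreRegular.mem_of_C_mul_mem _ hB.2 hd)
  by_cases hC : (X 3 : MvPolynomial (Fin 4) k) ∉ P.comap (Ideal.Quotient.mk (Ideal.span {f})) ∧ (2 : k) ≠ 0
  · refine HypersurfaceRegular.stub_hypersurfaceRegularOfPderiv k 4 f 3 P (fun hd => hC.1 ?_)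
    have e : pderiv 3 f = C 2 * X 3 := by rw [hf]; exact pderiv_three_f
    rw [e] at hd
    exact E8OffCentreRegular.mem_of_C_mul_mem _ hC.2 hd
  -- otherwise all three variables lie in `P₀ = P ∩ k[X]`, contradicting `hP`
  exfalso
  push Not at hA hB hC
  -- the three "closing" implications from `f ∈ P₀`
  have c1 : (X 2 : MvPolynomial (Fin 4) k) ∈ P.comap (Ideal.Quotient.mk (Ideal.span {f})) →
      (X 3 : MvPolynomial (Fin 4) k) ∈ P.comap (Ideal.Quotient.mk (Ideal.span {f})) →
      (X 1 : MvPolynomial (Fin 4) k) ∈ P.comap (Ideal.Quotient.mk (Ideal.span {f})) := fun h2 h3 => by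
    refine hprime.mem_of_pow_mem 3 ?_
    have e : (X 1 ^ 3 : MvPolynomial (Fin 4) k) = f - X 3 ^ 2 - X 2 ^ 5 := by rw [hf]; ring
    rw [e]
    exact Ideal.sub_mem _ (Ideal.sub_mem _ hfP (Ideal.pow_mem_of_mem _ h3 2 two_pos))
      (Ideal.pow_mem_of_mem _ h2 5 (by norm_num))
  have c2 : (X 1 : MvPolynomial (Fin 4) k) ∈ P.comap (Ideal.Quotient.mk (Ideal.span {f})) →
      (X 3 : MvPolynomial (Fin 4) k) ∈ P.comap (Ideal.Quotient.mk (Ideal.span {f})) →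
      (X 2 : MvPolynomial (Fin 4) k) ∈ P.comap (Ideal.Quotient.mk (Ideal.span {f})) := fun h1 h3 => by
    refine hprime.mem_of_pow_mem 5 ?_
    have e : (X 2 ^ 5 : MvPolynomial (Fin 4) k) = f - X 3 ^ 2 - X 1 ^ 3 := by rw [hf]; ring
    rw [e]
    exact Ideal.sub_mem _ (Ideal.sub_mem _ hfP (Ideal.pow_mem_of_mem _ h3 2 two_pos))
      (Ideal.pow_mem_of_mem _ h1 3 three_pos)
  have c3 : (X 1 : MvPolynomial (Fin 4) k) ∈ P.comap (Ideal.Quotient.mk (Ideal.span {f})) →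
      (X 2 : MvPolynomial (Fin 4) k) ∈ P.comap (Ideal.Quotient.mk (Ideal.span {f})) →
      (X 3 : MvPolynomial (Fin 4) k) ∈ P.comap (Ideal.Quotient.mk (Ideal.span {f})) := fun h1 h2 => by
    refine hprime.mem_of_pow_mem 2 ?_
    have e : (X 3 ^ 2 : MvPolynomial (Fin 4) k) = f - X 1 ^ 3 - X 2 ^ 5 := by rw [hf]; ring
    rw [e]
    exact Ideal.sub_mem _ (Ideal.sub_mem _ hfP (Ideal.pow_mem_of_mem _ h1 3 three_pos))
      (Ideal.pow_mem_of_mem _ h2 5 (by norm_num))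
  have hall : (X 1 : MvPolynomial (Fin 4) k) ∈ P.comap (Ideal.Quotient.mk (Ideal.span {f})) ∧
      (X 2 : MvPolynomial (Fin 4) k) ∈ P.comap (Ideal.Quotient.mk (Ideal.span {f})) ∧
      (X 3 : MvPolynomial (Fin 4) k) ∈ P.comap (Ideal.Quotient.mk (Ideal.span {f})) := by
    by_cases h3z : (3 : k) = 0
    · -- `5 ≠ 0` and `2 ≠ 0`: `X₂, X₃ ∈ P₀`, hence `X₁ ∈ P₀`
      have hx2 : (X 2 : MvPolynomial (Fin 4) k) ∈ P.comap (Ideal.Quotient.mk (Ideal.span {f})) := by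
        by_contra h; exact h35 h3z (hB h)
      have hx3 : (X 3 : MvPolynomial (Fin 4) k) ∈ P.comap (Ideal.Quotient.mk (Ideal.span {f})) := by
        by_contra h; exact h23 (hC h) h3z
      exact ⟨c1 hx2 hx3, hx2, hx3⟩
    · have hx1 : (X 1 : MvPolynomial (Fin 4) k) ∈ P.comap (Ideal.Quotient.mk (Ideal.span {f})) := by
        by_contra h; exact h3z (hA h)
      by_cases h5z : (5 : k) = 0
      · have hx3 : (X 3 : MvPolynomial (Fin 4) k) ∈ P.comap (Ideal.Quotient.mk (Ideal.span {f})) := by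
          by_contra h; exact h25 (hC h) h5z
        exact ⟨hx1, c2 hx1 hx3, hx3⟩
      · have hx2 : (X 2 : MvPolynomial (Fin 4) k) ∈ P.comap (Ideal.Quotient.mk (Ideal.span {f})) := by
          by_contra h; exact h5z (hB h)
        exact ⟨hx1, hx2, c3 hx1 hx2⟩
  obtain ⟨h1, h2, h3⟩ := hall
  refine hP ?_
  rw [Ideal.span_le]
  rintro _ ⟨j, hj, rfl⟩
  simp only [Finset.coe_insert, Finset.coe_singleton, Set.mem_insert_iff, Set.mem_singleton_iff] at hj
  rcases hj with rfl | rfl | rfl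
  exacts [h1, h2, h3]

/-! ## The clause off the line, and the model -/

/-- **Off-stratum regularity ⇒ the relative engines' hoff hypothesis**: if `R = k[X]/(f)` (characteristic `p`) is regular
at every prime not containing `(x̄ⱼ : j ∈ J)`, then at every maximal ideal missing some `x̄ⱼ`, `j ∈ J`, the local ring
satisfies the per-stalk clause of the crux (`FiClauseOfRegular`). Relative form of
`E8WeightedData.offOrigin_clause_of_regular`. [folklore] -/
theorem offStratum_clause_of_regular (p : ℕ) [Fact p.Prime] (k : Type) [Field k] [CharP k p] {n : ℕ}
    (J : Finset (Fin n)) (f : MvPolynomial (Fin n) k)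
    (hreg : ∀ (P : Ideal (MvPolynomial (Fin n) k ⧸ Ideal.span {f})) [P.IsPrime],
      ¬ Ideal.span ((fun j : Fin n => Ideal.Quotient.mk (Ideal.span {f}) (MvPolynomial.X j)) '' (J : Set (Fin n))) ≤ P →
      IsRegularLocalRing (Localization.AtPrime P)) :
    ∀ (Q : Ideal (MvPolynomial (Fin n) k ⧸ Ideal.span {f})) [Q.IsMaximal],
      (∃ j ∈ J, Ideal.Quotient.mk (Ideal.span {f}) (MvPolynomial.X j) ∉ Q) →
      ∀ d : ℕ, ringKrullDim (Localization.AtPrime Q) = d → ∀ s : Fin d → Localization.AtPrime Q,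
        (Ideal.span (Set.range s)).radical.IsMaximal →
          RingTheory.Sequence.IsWeaklyRegular (Localization.AtPrime Q) (List.ofFn s) ∧
          ∀ y : Localization.AtPrime Q, (∃ e : ℕ, y ^ p ^ e ∈ Ideal.span
            ((fun z : Localization.AtPrime Q => z ^ p ^ e) ''
              (Ideal.span (Set.range s) : Set (Localization.AtPrime Q)))) → y ∈ Ideal.span (Set.range s) := by
  intro Q _ hQ
  obtain ⟨j, hjJ, hj⟩ := hQ
  have hle : ¬ Ideal.span ((fun j : Fin n => Ideal.Quotient.mk (Ideal.span {f}) (MvPolynomial.X j)) '' (J : Set (Fin n))) ≤ Q :=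
    fun hle => hj (hle (Ideal.subset_span (Set.mem_image_of_mem _ (Finset.mem_coe.mpr hjJ))))
  haveI : IsRegularLocalRing (Localization.AtPrime Q) := hreg Q hle
  by_cases htriv : Nontrivial (MvPolynomial (Fin n) k ⧸ Ideal.span {f})
  · haveI := htriv
    haveI : CharP (MvPolynomial (Fin n) k ⧸ Ideal.span {f}) p :=
      charP_of_injective_algebraMap (algebraMap k (MvPolynomial (Fin n) k ⧸ Ideal.span {f})).injective p
    haveI : CharP (Localization.AtPrime Q) p := DegreeZeroDescent.charP_localization_atPrime p Q
    exact (FiClauseOfRegular.stub_fiClauseOfRegular p (Localization.AtPrime Q)).2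
  · exfalso
    rw [not_nontrivial_iff_subsingleton] at htriv
    exact Ideal.IsMaximal.ne_top ‹Q.IsMaximal› (Subsingleton.elim _ _)

/-- **G6-rel: `E₈⁰ × 𝔸¹` HAS AN F-INJECTIVE MACAULAYFICATION BY ONE WEIGHTED BLOW-UP ALONG ITS BAD LINE, AT EVERY PRIME `p`.**
For every field `k` of characteristic `p` and `f = X₃² + X₁³ + X₂⁵ ∈ k[X₀,…,X₃]`, `Spec k[X]/(f)` has a proper birational
model with domain stalks satisfying the crux clause (Cohen–Macaulay, Frobenius-closed parameter ideals) at EVERY point: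
the relative graded engine `gradedConeFiModelRel` with `J = {1,2,3}`, weights `(0,10,6,15)`, `N = 30`, charts `X₁³, X₂⁵, X₃²`.
The first kernel-checked crux instance of GRADED type whose bad locus is a CURVE. [folklore] -/
theorem e8LineGradedFiModel : ∀ (p : ℕ) [Fact p.Prime] (k : Type) [Field k] [CharP k p]
    (f : MvPolynomial (Fin 4) k), f = MvPolynomial.X 3 ^ 2 + MvPolynomial.X 1 ^ 3 + MvPolynomial.X 2 ^ 5 →
    ∃ (X' : Scheme.{0}) (π : X' ⟶ Spec (.of (MvPolynomial (Fin 4) k ⧸ Ideal.span {f}))), IsProper π ∧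
      Literature.AlgebraicGeometry.Resolution.IsBirational π ∧
      ∀ y : X', IsDomain (X'.presheaf.stalk y) ∧ ∀ d : ℕ, ringKrullDim (X'.presheaf.stalk y) = d →
        ∀ s : Fin d → X'.presheaf.stalk y, (Ideal.span (Set.range s)).radical.IsMaximal →
          RingTheory.Sequence.IsWeaklyRegular (X'.presheaf.stalk y) (List.ofFn s) ∧
          ∀ z : X'.presheaf.stalk y, (∃ e : ℕ, z ^ p ^ e ∈
              Ideal.span ((fun w : X'.presheaf.stalk y => w ^ p ^ e) ''
                (Ideal.span (Set.range s) : Set (X'.presheaf.stalk y)))) →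
            z ∈ Ideal.span (Set.range s) := by
  intro p _ k _ _ f hf
  have hwc : ∀ v ∈ ({1, 2, 3} : Finset (Fin 4)), 0 < (![0, 10, 6, 15] : Fin 4 → ℕ) v ∧
      (![0, 3, 5, 2] : Fin 4 → ℕ) v * (![0, 10, 6, 15] : Fin 4 → ℕ) v = 30 := by
    intro v hv
    simp only [Finset.mem_insert, Finset.mem_singleton] at hv
    rcases hv with rfl | rfl | rfl <;> decide
  have hw0 : ∀ v : Fin 4, v ∉ ({1, 2, 3} : Finset (Fin 4)) → (![0, 10, 6, 15] : Fin 4 → ℕ) v = 0 := by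
    intro v hv
    fin_cases v
    · rfl
    all_goals exact absurd (by decide) hv
  exact GradedConeFiModelRel.gradedConeFiModelRel p k 4 ({1, 2, 3} : Finset (Fin 4)) ⟨1, by decide⟩
    (![0, 10, 6, 15] : Fin 4 → ℕ) 30 (![0, 3, 5, 2] : Fin 4 → ℕ) (by norm_num) hwc hw0 (veroneseSplitting k)
    f 30 (hf ▸ f_isWeightedHomogeneous k) (isPrime_span_f k f hf) (X_ne_zero k f hf)
    (offStratum_clause_of_regular p k _ f (fun P _ hP => regular_off_line k f hf P hP))

end Summit.ResolutionOfSingularities.ResolutionOfSingularities.Theorems.FInjectiveMacaulayfication.E8LineGradedFiModel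

end
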